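import Mathlib.Analysis.Distribution.AEEqOfIntegralContDiff
import Mathlib.Analysis.Calculus.BumpFunction.Normed
import Mathlib.Analysis.Calculus.BumpFunction.InnerProduct
import Mathlib.MeasureTheory.Integral.IntervalIntegral.IntegrationByParts
import Mathlib.MeasureTheory.Integral.IntervalIntegral.FundThmCalculus
import Mathlib.Analysis.Calculus.Deriv.MeanValue
import Mathlib.Analysis.Calculus.Deriv.Support
import HarnessLib

/-!
# Test-function calculus on an open interval, I: du Bois-Reymond lemmas

Sub-problem `CriticalPhenomena/CardyFormulaZ2`; crux
`Summit.CriticalPhenomena.CardyFormulaZ2.Theses.CardyUniqueLimit.CardyRigidity`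
(stmt-CriticalPhenomena-0746), line `crossing_martingale` (skeleton `Lines/crossing_martingale.lean`,
definitions module `Theorems/CardyUniqueLimitCardyRigidityDefs.lean`), STUB C `stub_kernelAffineBeta`
("a crossing-martingale kernel is affine-beta", general continuous `f`).

This is the first of two files of pure real analysis behind the REGULARITY BOOTSTRAP of STUB C:
the far-field expansion of the level-stopped crossing martingales of a regular driving process,
integrated against a test function `ψ(θ)` of the translation parameter of the marks, yields for a
merely continuous kernel `f` the identities `κ ∫ F ψ'' = ∫ F (w ψ)'` (`F = f ∘ η`, see
`HasFarFieldIdentities` in `…FarFieldBase`); the lemmas here and in `…Bootstrap` turn such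
distributional identities into classical ODEs.

* `TestFunction.exists_bump_integral_one`, `TestFunction.primitive_test` — bumps, and the
  primitive of a zero-mean test function is a test function;
* `TestFunction.eqOn_const_of_integral_deriv` — du Bois-Reymond, order one
  (`∫ F ψ' = 0 ∀ψ ⇒ F` constant), from Mathlib's
  `IsOpen.ae_eq_zero_of_integral_contDiff_smul_eq_zero`;
* `TestFunction.integral_mul_deriv_test` — integration by parts against a test function;
* `TestFunction.eqOn_affine_of_integral_deriv_deriv` — du Bois-Reymond, order two
  (`∫ F ψ'' = 0 ∀ψ ⇒ F` affine); registered glue sub-goal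
  `testFunction_affine_of_integral_deriv_deriv`.

References: the classical lemma of du Bois-Reymond (1879); L. Hörmander, *The Analysis of Linear
Partial Differential Operators I*, Thm 3.1.4.
-/

noncomputable section

open MeasureTheory Filter Set Topology

namespace Summit.CriticalPhenomena.CardyFormulaZ2.Cruxes.CardyRigidity.CrossingMartingale

namespace TestFunction

/-- A smooth bump with integral one supported inside a given open interval. [folklore] -/
theorem exists_bump_integral_one {L R : ℝ} (hLR : L < R) :
    ∃ η₀ : ℝ → ℝ, ContDiff ℝ (⊤ : ℕ∞) η₀ ∧ HasCompactSupport η₀ ∧ tsupport η₀ ⊆ Ioo L R ∧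
      ∫ θ, η₀ θ = 1 := by
  set c : ℝ := (L + R) / 2 with hc
  have hr : 0 < (R - L) / 4 := by linarith
  let b : ContDiffBump c := ⟨(R - L) / 8, (R - L) / 4, by linarith, by linarith⟩
  refine ⟨b.normed volume, b.contDiff_normed, b.hasCompactSupport_normed, ?_, b.integral_normed⟩
  rw [b.tsupport_normed_eq]
  intro x hx
  rw [Metric.mem_closedBall, Real.dist_eq] at hx
  have hx' : |x - c| ≤ (R - L) / 4 := hx
  rw [abs_le] at hx'
  constructor <;> [linarith [hx'.1]; linarith [hx'.2]]

/-- A continuous function vanishing off `tsupport ⊆ Icc l r` vanishes on `Iic l` and `Ici r`.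
[folklore] -/
theorem eq_zero_of_le {φ : ℝ → ℝ} {l r : ℝ} (hsupp : tsupport φ ⊆ Ioo l r)
    {x : ℝ} (hx : x ≤ l ∨ r ≤ x) : φ x = 0 := by
  apply image_eq_zero_of_notMem_tsupport
  intro hmem
  have := hsupp hmem
  rcases hx with h | h
  · exact absurd this.1 (not_lt.2 h)
  · exact absurd this.2 (not_lt.2 h)

/-- The integral over `ℝ` of a function supported in `Ioo l r` is its interval integral.
[folklore] -/
theorem integral_eq_intervalIntegral {g : ℝ → ℝ} {l r : ℝ}
    (hg : ∀ x, x ≤ l ∨ r ≤ x → g x = 0) : ∫ x, g x = ∫ x in l..r, g x := by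
  symm
  apply intervalIntegral.integral_eq_integral_of_support_subset
  intro x hx
  rw [Function.mem_support] at hx
  by_contra hx'
  rw [mem_Ioc, not_and_or, not_lt, not_le] at hx'
  rcases hx' with h | h
  · exact hx (hg _ (Or.inl h))
  · exact hx (hg _ (Or.inr h.le))

/-- **Primitive of a test function with zero integral is a test function.** [folklore] -/
theorem primitive_test {φ : ℝ → ℝ} (hφ : ContDiff ℝ (⊤ : ℕ∞) φ) {l r : ℝ}
    (hsupp : tsupport φ ⊆ Ioo l r) (hint : ∫ x, φ x = 0) :
    ContDiff ℝ (⊤ : ℕ∞) (fun θ ↦ ∫ x in l..θ, φ x) ∧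
      tsupport (fun θ ↦ ∫ x in l..θ, φ x) ⊆ Icc l r ∧
      HasCompactSupport (fun θ ↦ ∫ x in l..θ, φ x) ∧
      ∀ θ, HasDerivAt (fun θ ↦ ∫ x in l..θ, φ x) (φ θ) θ := by
  have hc : Continuous φ := hφ.continuous
  have hderiv : ∀ θ, HasDerivAt (fun θ ↦ ∫ x in l..θ, φ x) (φ θ) θ := fun θ ↦
    intervalIntegral.integral_hasDerivAt_right (hc.intervalIntegrable _ _)
      (hc.stronglyMeasurableAtFilter _ _) hc.continuousAt
  have hd : deriv (fun θ ↦ ∫ x in l..θ, φ x) = φ := funext fun θ ↦ (hderiv θ).deriv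
  have hsmooth : ContDiff ℝ (⊤ : ℕ∞) (fun θ ↦ ∫ x in l..θ, φ x) := by
    rw [contDiff_infty_iff_deriv, hd]
    exact ⟨fun θ ↦ (hderiv θ).differentiableAt, hφ⟩
  have hzero : ∀ θ, θ ≤ l ∨ r ≤ θ → (∫ x in l..θ, φ x) = 0 := by
    intro θ hθ
    rcases hθ with h | h
    · rw [intervalIntegral.integral_symm]
      rw [intervalIntegral.integral_congr (g := fun _ ↦ (0 : ℝ)) ?_]
      · simp
      · intro x hx
        rw [uIcc_of_le h] at hx
        exact eq_zero_of_le hsupp (Or.inl hx.2)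
    · rw [← intervalIntegral.integral_add_adjacent_intervals (b := r)
        (hc.intervalIntegrable _ _) (hc.intervalIntegrable _ _)]
      rw [← integral_eq_intervalIntegral (fun x hx ↦ eq_zero_of_le hsupp hx), hint,
        zero_add]
      rw [intervalIntegral.integral_congr (g := fun _ ↦ (0 : ℝ)) ?_]
      · simp
      · intro x hx
        rw [uIcc_of_le h] at hx
        exact eq_zero_of_le hsupp (Or.inr hx.1)
  have hsupp' : Function.support (fun θ ↦ ∫ x in l..θ, φ x) ⊆ Icc l r := by
    intro θ hθ
    rw [Function.mem_support] at hθ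
    by_contra h
    rw [mem_Icc, not_and_or, not_le, not_le] at h
    rcases h with h | h
    · exact hθ (hzero θ (Or.inl h.le))
    · exact hθ (hzero θ (Or.inr h.le))
  have htsupp : tsupport (fun θ ↦ ∫ x in l..θ, φ x) ⊆ Icc l r :=
    closure_minimal hsupp' isClosed_Icc
  exact ⟨hsmooth, htsupp, HasCompactSupport.intro' isCompact_Icc isClosed_Icc
    (fun θ hθ ↦ by_contra fun h ↦ hθ (hsupp' h)), hderiv⟩

/-- Restriction of a test function identity to an interval integral: if `g` is continuous and
vanishes off `Ioo l r` then `∫ g = ∫_{l}^{r} g`. [folklore] -/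
theorem integral_eq_intervalIntegral_of_tsupport {g : ℝ → ℝ} {l r : ℝ}
    (hg : tsupport g ⊆ Ioo l r) : ∫ x, g x = ∫ x in l..r, g x :=
  integral_eq_intervalIntegral fun _ hx ↦ eq_zero_of_le hg hx

/-- A function continuous on an open interval times a test function of the interval is
continuous on `ℝ`. [folklore] -/
theorem continuous_mul_test {F φ : ℝ → ℝ} {L R : ℝ} (hF : ContinuousOn F (Ioo L R))
    (hφ : Continuous φ) (hφs : tsupport φ ⊆ Ioo L R) : Continuous fun θ ↦ F θ * φ θ := by
  rw [continuous_iff_continuousAt]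
  intro x
  by_cases hx : x ∈ Ioo L R
  · exact (hF.continuousAt (Ioo_mem_nhds hx.1 hx.2)).mul hφ.continuousAt
  · have hx' : x ∉ tsupport φ := fun h ↦ hx (hφs h)
    have hev : (fun θ ↦ F θ * φ θ) =ᶠ[𝓝 x] fun _ ↦ 0 := by
      filter_upwards [notMem_tsupport_iff_eventuallyEq.1 hx'] with θ hθ
      simp [hθ]
    exact (continuousAt_const.congr hev.symm)

/-- … and integrable. [folklore] -/
theorem integrable_mul_test {F φ : ℝ → ℝ} {L R : ℝ} (hF : ContinuousOn F (Ioo L R))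
    (hφ : Continuous φ) (hφc : HasCompactSupport φ) (hφs : tsupport φ ⊆ Ioo L R) :
    Integrable fun θ ↦ F θ * φ θ :=
  (continuous_mul_test hF hφ hφs).integrable_of_hasCompactSupport hφc.mul_left

/-- **du Bois-Reymond, order one.** A function continuous on an open interval whose integral
against the derivative of every test function of the interval vanishes is constant there.
[folklore] -/
theorem eqOn_const_of_integral_deriv {F : ℝ → ℝ} {L R : ℝ} (hLR : L < R)
    (hF : ContinuousOn F (Ioo L R))
    (h : ∀ ψ : ℝ → ℝ, ContDiff ℝ (⊤ : ℕ∞) ψ → HasCompactSupport ψ → tsupport ψ ⊆ Ioo L R →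
      ∫ θ, F θ * deriv ψ θ = 0) :
    ∃ c : ℝ, EqOn F (fun _ ↦ c) (Ioo L R) := by
  obtain ⟨η₀, hη₀, hη₀c, hη₀s, hη₀i⟩ := exists_bump_integral_one hLR
  set c : ℝ := ∫ θ, F θ * η₀ θ with hc
  refine ⟨c, ?_⟩
  -- every test function `φ` of the interval pairs to zero with `F - c`
  have key : ∀ φ : ℝ → ℝ, ContDiff ℝ (⊤ : ℕ∞) φ → HasCompactSupport φ → tsupport φ ⊆ Ioo L R →
      ∫ θ, φ θ * (F θ - c) = 0 := by
    intro φ hφ hφc hφs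
    -- a common compact window `[l, r] ⊆ (L, R)` for `φ` and `η₀`
    obtain ⟨l, r, hl, hr, hlr, hφlr, hηlr⟩ : ∃ l r, L < l ∧ r < R ∧ l < r ∧
        tsupport φ ⊆ Ioo l r ∧ tsupport η₀ ⊆ Ioo l r := by
      have hK : IsCompact (tsupport φ ∪ tsupport η₀) := hφc.union hη₀c
      have hKs : tsupport φ ∪ tsupport η₀ ⊆ Ioo L R := union_subset hφs hη₀s
      by_cases hne : (tsupport φ ∪ tsupport η₀).Nonempty
      · obtain ⟨a, ha, hamin⟩ := hK.exists_isMinOn hne continuousOn_id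
        obtain ⟨b, hb, hbmax⟩ := hK.exists_isMaxOn hne continuousOn_id
        have haL : L < a := (hKs ha).1
        have hbR : b < R := (hKs hb).2
        refine ⟨(L + a) / 2, (b + R) / 2, by linarith, by linarith, ?_, ?_, ?_⟩
        · have hab : a ≤ b := hamin hb
          linarith
        · intro x hx
          have h1 : a ≤ x := hamin (Or.inl hx)
          have h2 : x ≤ b := hbmax (Or.inl hx)
          constructor <;> linarith
        · intro x hx
          have h1 : a ≤ x := hamin (Or.inr hx)
          have h2 : x ≤ b := hbmax (Or.inr hx)
          constructor <;> linarith
      · rw [not_nonempty_iff_eq_empty, union_empty_iff] at hne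
        refine ⟨(2 * L + R) / 3, (L + 2 * R) / 3, by linarith, by linarith, by linarith, ?_, ?_⟩
        · rw [hne.1]; exact empty_subset _
        · rw [hne.2]; exact empty_subset _
    -- the corrected test function `φ₁ = φ - (∫ φ) η₀` has zero integral; its primitive is a test function
    set m : ℝ := ∫ θ, φ θ with hm
    set φ₁ : ℝ → ℝ := fun θ ↦ φ θ - m * η₀ θ with hφ₁
    have hφ₁d : ContDiff ℝ (⊤ : ℕ∞) φ₁ := hφ.sub (contDiff_const.mul hη₀)
    have hφ₁s : tsupport φ₁ ⊆ Ioo l r := by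
      refine (tsupport_sub _ _).trans (union_subset hφlr ?_)
      exact (tsupport_mul_subset_right (f := fun _ ↦ m) (g := η₀)).trans hηlr
    have hφi : Integrable φ := hφ.continuous.integrable_of_hasCompactSupport hφc
    have hηi : Integrable η₀ := hη₀.continuous.integrable_of_hasCompactSupport hη₀c
    have hφ₁i : ∫ θ, φ₁ θ = 0 := by
      simp only [hφ₁]
      rw [MeasureTheory.integral_sub hφi (hηi.const_mul m), MeasureTheory.integral_const_mul, hη₀i,
        mul_one, sub_self]
    obtain ⟨hΨd, hΨs, hΨc, hΨ'⟩ := primitive_test hφ₁d hφ₁s hφ₁i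
    have hΨs' : tsupport (fun θ ↦ ∫ x in l..θ, φ₁ x) ⊆ Ioo L R :=
      hΨs.trans (Icc_subset_Ioo hl hr)
    have h0 := h _ hΨd hΨc hΨs'
    have hdΨ : deriv (fun θ ↦ ∫ x in l..θ, φ₁ x) = φ₁ := funext fun θ ↦ (hΨ' θ).deriv
    rw [hdΨ] at h0
    -- unfold: `0 = ∫ F φ₁ = ∫ F φ - m ∫ F η₀ = ∫ F φ - m c`
    have hFφ : Integrable fun θ ↦ F θ * φ θ := integrable_mul_test hF hφ.continuous hφc hφs
    have hFη : Integrable fun θ ↦ F θ * η₀ θ :=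
      integrable_mul_test hF hη₀.continuous hη₀c hη₀s
    have h1 : ∫ θ, F θ * φ₁ θ = (∫ θ, F θ * φ θ) - m * c := by
      simp only [hφ₁, mul_sub]
      rw [MeasureTheory.integral_sub hFφ]
      · rw [hc]
        rw [← MeasureTheory.integral_const_mul]
        congr 1
        refine integral_congr_ae (Eventually.of_forall fun θ ↦ ?_)
        simp only; ring
      · have := hFη.const_mul m
        refine this.congr (Eventually.of_forall fun θ ↦ ?_)
        ring
    rw [h1] at h0
    calc ∫ θ, φ θ * (F θ - c) = (∫ θ, F θ * φ θ) - c * m := by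
          simp only [mul_sub]
          rw [MeasureTheory.integral_sub, hm, ← MeasureTheory.integral_const_mul]
          · congr 1
            · exact integral_congr_ae (Eventually.of_forall fun θ ↦ by simp only; ring)
            · exact integral_congr_ae (Eventually.of_forall fun θ ↦ by simp only; ring)
          · exact hFφ.congr (Eventually.of_forall fun θ ↦ by simp only; ring)
          · exact (hφi.const_mul c).congr (Eventually.of_forall fun θ ↦ by simp only; ring)
      _ = 0 := by rw [mul_comm c m]; linarith
  -- hence `F = c` a.e. on the interval, and everywhere by continuity
  have hae := (isOpen_Ioo (a := L) (b := R)).ae_eq_zero_of_integral_contDiff_smul_eq_zero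
    (f := fun θ ↦ F θ - c) (μ := volume)
    ((hF.sub continuousOn_const).locallyIntegrableOn measurableSet_Ioo)
    (fun g hg hgc hgs ↦ by simpa [smul_eq_mul] using key g hg hgc hgs)
  have hae' : (fun θ ↦ F θ) =ᵐ[volume.restrict (Ioo L R)] fun _ ↦ c := by
    rw [EventuallyEq, ae_restrict_iff' measurableSet_Ioo]
    exact hae.mono fun θ hθ hmem ↦ sub_eq_zero.1 (hθ hmem)
  exact Measure.eqOn_open_of_ae_eq hae' isOpen_Ioo hF continuousOn_const

/-- A compact subset of an open interval sits inside a strictly smaller open window. [folklore] -/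
theorem exists_window {K : Set ℝ} (hK : IsCompact K) {L R : ℝ} (hLR : L < R) (hKs : K ⊆ Ioo L R) :
    ∃ l r, L < l ∧ l < r ∧ r < R ∧ K ⊆ Ioo l r := by
  by_cases hne : K.Nonempty
  · obtain ⟨a, ha, hamin⟩ := hK.exists_isMinOn hne continuousOn_id
    obtain ⟨b, hb, hbmax⟩ := hK.exists_isMaxOn hne continuousOn_id
    have haL : L < a := (hKs ha).1
    have hbR : b < R := (hKs hb).2
    have hab : a ≤ b := hamin hb
    refine ⟨(L + a) / 2, (b + R) / 2, by linarith, by linarith, by linarith, ?_⟩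
    intro x hx
    have h1 : a ≤ x := hamin hx
    have h2 : x ≤ b := hbmax hx
    constructor <;> linarith
  · rw [not_nonempty_iff_eq_empty] at hne
    refine ⟨(2 * L + R) / 3, (L + 2 * R) / 3, by linarith, by linarith, by linarith, ?_⟩
    rw [hne]; exact empty_subset _

/-- **Integration by parts against a test function**: `∫ u ψ' = -∫ u' ψ` for `u ∈ C¹` on the
open interval carrying the test function `ψ`. [folklore] -/
theorem integral_mul_deriv_test {u u' ψ : ℝ → ℝ} {L R : ℝ} (hLR : L < R)
    (hu : ∀ θ ∈ Ioo L R, HasDerivAt u (u' θ) θ) (hu' : ContinuousOn u' (Ioo L R))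
    (hψ : ContDiff ℝ (⊤ : ℕ∞) ψ) (hψc : HasCompactSupport ψ) (hψs : tsupport ψ ⊆ Ioo L R) :
    ∫ θ, u θ * deriv ψ θ = -∫ θ, u' θ * ψ θ := by
  obtain ⟨l, r, hl, hlr, hr, hψlr⟩ := exists_window hψc hLR hψs
  have hψ1 : ContDiff ℝ 1 ψ := hψ.of_le (by exact_mod_cast le_top)
  have hdψc : Continuous (deriv ψ) := hψ1.continuous_deriv_one
  have hdψs : tsupport (deriv ψ) ⊆ Ioo l r := tsupport_deriv_subset.trans hψlr
  have hIcc : Icc l r ⊆ Ioo L R := Icc_subset_Ioo hl hr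
  have huIcc : uIcc l r ⊆ Ioo L R := by rw [uIcc_of_le hlr.le]; exact hIcc
  rw [integral_eq_intervalIntegral (l := l) (r := r), integral_eq_intervalIntegral (l := l) (r := r)]
  · rw [intervalIntegral.integral_mul_deriv_eq_deriv_mul (u := u) (u' := u') (v := ψ)
      (v' := deriv ψ) (fun x hx ↦ hu x (huIcc hx))
      (fun x _ ↦ (hψ1.differentiable (by norm_num)).differentiableAt.hasDerivAt)
      ((hu'.mono huIcc).intervalIntegrable) (hdψc.intervalIntegrable _ _)]
    rw [eq_zero_of_le hψlr (Or.inl le_rfl), eq_zero_of_le hψlr (Or.inr le_rfl)]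
    simp
  · intro x hx
    rw [eq_zero_of_le hψlr hx, mul_zero]
  · intro x hx
    rw [eq_zero_of_le hdψs hx, mul_zero]

/-- `∫ θ ψ'(θ) dθ = -∫ ψ` for a test function `ψ`. [folklore] -/
theorem integral_id_mul_deriv_test {ψ : ℝ → ℝ} {L R : ℝ} (hLR : L < R)
    (hψ : ContDiff ℝ (⊤ : ℕ∞) ψ) (hψc : HasCompactSupport ψ) (hψs : tsupport ψ ⊆ Ioo L R) :
    ∫ θ, θ * deriv ψ θ = -∫ θ, ψ θ := by
  have := integral_mul_deriv_test (u := fun θ ↦ θ) (u' := fun _ ↦ (1 : ℝ)) hLR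
    (fun θ _ ↦ hasDerivAt_id θ) continuousOn_const hψ hψc hψs
  simpa using this

/-- **du Bois-Reymond, order two.** A function continuous on an open interval whose integral
against the second derivative of every test function vanishes is affine there. [folklore] -/
theorem eqOn_affine_of_integral_deriv_deriv {F : ℝ → ℝ} {L R : ℝ} (hLR : L < R)
    (hF : ContinuousOn F (Ioo L R))
    (h : ∀ ψ : ℝ → ℝ, ContDiff ℝ (⊤ : ℕ∞) ψ → HasCompactSupport ψ → tsupport ψ ⊆ Ioo L R →
      ∫ θ, F θ * deriv (deriv ψ) θ = 0) :
    ∃ α β : ℝ, EqOn F (fun θ ↦ α * θ + β) (Ioo L R) := by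
  obtain ⟨η₀, hη₀, hη₀c, hη₀s, hη₀i⟩ := exists_bump_integral_one hLR
  set α : ℝ := -∫ θ, F θ * deriv η₀ θ with hα
  -- first: `∫ F φ' = -α ∫ φ` for every test function `φ`
  have step : ∀ φ : ℝ → ℝ, ContDiff ℝ (⊤ : ℕ∞) φ → HasCompactSupport φ → tsupport φ ⊆ Ioo L R →
      ∫ θ, F θ * deriv φ θ = -α * ∫ θ, φ θ := by
    intro φ hφ hφc hφs
    obtain ⟨l, r, hl, hlr, hr, hKlr⟩ := exists_window (hφc.union hη₀c) hLR (union_subset hφs hη₀s)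
    have hφlr : tsupport φ ⊆ Ioo l r := subset_union_left.trans hKlr
    have hηlr : tsupport η₀ ⊆ Ioo l r := subset_union_right.trans hKlr
    set m : ℝ := ∫ θ, φ θ with hm
    set φ₁ : ℝ → ℝ := fun θ ↦ φ θ - m * η₀ θ with hφ₁
    have hφ₁d : ContDiff ℝ (⊤ : ℕ∞) φ₁ := hφ.sub (contDiff_const.mul hη₀)
    have hφ₁s : tsupport φ₁ ⊆ Ioo l r := by
      refine (tsupport_sub _ _).trans (union_subset hφlr ?_)
      exact (tsupport_mul_subset_right (f := fun _ ↦ m) (g := η₀)).trans hηlr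
    have hφi : Integrable φ := hφ.continuous.integrable_of_hasCompactSupport hφc
    have hηi : Integrable η₀ := hη₀.continuous.integrable_of_hasCompactSupport hη₀c
    have hφ₁i : ∫ θ, φ₁ θ = 0 := by
      simp only [hφ₁]
      rw [MeasureTheory.integral_sub hφi (hηi.const_mul m), MeasureTheory.integral_const_mul, hη₀i,
        mul_one, sub_self]
    obtain ⟨hΨd, hΨs, hΨc, hΨ'⟩ := primitive_test hφ₁d hφ₁s hφ₁i
    have hΨs' : tsupport (fun θ ↦ ∫ x in l..θ, φ₁ x) ⊆ Ioo L R :=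
      hΨs.trans (Icc_subset_Ioo hl hr)
    have h0 := h _ hΨd hΨc hΨs'
    have hdΨ : deriv (fun θ ↦ ∫ x in l..θ, φ₁ x) = φ₁ := funext fun θ ↦ (hΨ' θ).deriv
    rw [hdΨ] at h0
    -- `deriv φ₁ = deriv φ - m deriv η₀`
    have hφ1 : ContDiff ℝ 1 φ := hφ.of_le (by exact_mod_cast le_top)
    have hη1 : ContDiff ℝ 1 η₀ := hη₀.of_le (by exact_mod_cast le_top)
    have hdφ₁ : deriv φ₁ = fun θ ↦ deriv φ θ - m * deriv η₀ θ := by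
      funext θ
      simp only [hφ₁]
      have h1 := (hφ1.differentiable (by norm_num)).differentiableAt (x := θ) |>.hasDerivAt
      have h2 := (hη1.differentiable (by norm_num)).differentiableAt (x := θ) |>.hasDerivAt
      exact (h1.sub (h2.const_mul m)).deriv
    rw [hdφ₁] at h0
    have hFφ : Integrable fun θ ↦ F θ * deriv φ θ :=
      integrable_mul_test hF hφ1.continuous_deriv_one hφc.deriv (tsupport_deriv_subset.trans hφs)
    have hFη : Integrable fun θ ↦ F θ * deriv η₀ θ :=
      integrable_mul_test hF hη1.continuous_deriv_one hη₀c.deriv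
        (tsupport_deriv_subset.trans hη₀s)
    have h1 : ∫ θ, F θ * (deriv φ θ - m * deriv η₀ θ) =
        (∫ θ, F θ * deriv φ θ) - m * ∫ θ, F θ * deriv η₀ θ := by
      simp only [mul_sub]
      rw [MeasureTheory.integral_sub hFφ, ← MeasureTheory.integral_const_mul]
      · congr 1
        exact integral_congr_ae (Eventually.of_forall fun θ ↦ by simp only; ring)
      · exact (hFη.const_mul m).congr (Eventually.of_forall fun θ ↦ by simp only; ring)
    rw [h1] at h0
    rw [hα]
    linarith
  -- second: `F - α id` pairs to zero with every `φ'`, hence is constant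
  have hG : ContinuousOn (fun θ ↦ F θ - α * θ) (Ioo L R) :=
    hF.sub (continuousOn_const.mul continuousOn_id)
  obtain ⟨β, hβ⟩ := eqOn_const_of_integral_deriv hLR hG fun φ hφ hφc hφs ↦ by
    have hφ1 : ContDiff ℝ 1 φ := hφ.of_le (by exact_mod_cast le_top)
    have hFφ : Integrable fun θ ↦ F θ * deriv φ θ :=
      integrable_mul_test hF hφ1.continuous_deriv_one hφc.deriv (tsupport_deriv_subset.trans hφs)
    have hiφ : Integrable fun θ ↦ θ * deriv φ θ :=
      integrable_mul_test continuousOn_id hφ1.continuous_deriv_one hφc.deriv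
        (tsupport_deriv_subset.trans hφs)
    have h2 : ∫ θ, (F θ - α * θ) * deriv φ θ =
        (∫ θ, F θ * deriv φ θ) - α * ∫ θ, θ * deriv φ θ := by
      simp only [sub_mul]
      rw [MeasureTheory.integral_sub hFφ, ← MeasureTheory.integral_const_mul]
      · congr 1
        exact integral_congr_ae (Eventually.of_forall fun θ ↦ by simp only; ring)
      · exact (hiφ.const_mul α).congr (Eventually.of_forall fun θ ↦ by simp only; ring)
    rw [h2, step φ hφ hφc hφs, integral_id_mul_deriv_test hLR hφ hφc hφs]
    ring
  refine ⟨α, β, fun θ hθ ↦ ?_⟩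
  have := hβ hθ
  simp only at this
  linarith

end TestFunction

/-- **du Bois-Reymond of order two** (registered glue sub-goal of stmt-CriticalPhenomena-0746, STUB C
toolkit): a function continuous on an open interval whose integral against `ψ''` vanishes for
every test function `ψ` of the interval is affine there. [folklore] -/
theorem testFunction_affine_of_integral_deriv_deriv : ∀ {F : ℝ → ℝ} {L R : ℝ}, L < R → ContinuousOn F (Ioo L R) → (∀ ψ : ℝ → ℝ, ContDiff ℝ (⊤ : ℕ∞) ψ → HasCompactSupport ψ → tsupport ψ ⊆ Ioo L R → ∫ θ, F θ * deriv (deriv ψ) θ = 0) → ∃ α β : ℝ, EqOn F (fun θ ↦ α * θ + β) (Ioo L R) :=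
  fun hLR hF h ↦ TestFunction.eqOn_affine_of_integral_deriv_deriv hLR hF h

end Summit.CriticalPhenomena.CardyFormulaZ2.Cruxes.CardyRigidity.CrossingMartingale

end
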